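import Summits.BirchSwinnertonDyer.BirchSwinnertonDyer.Theorems.SylvesterTwoHeegnerIndexLocalTypes
import Summits.BirchSwinnertonDyer.Rank1Residual.X12.InertBadLocalTypesThree
import Literature.NumberTheory.EllipticCurves.NeronComponentIndex
import Literature.NumberTheory.EllipticCurves.TamagawaSubgroupProofs
import HarnessLib

/-!
# Route `SylvesterTwoHeegnerIndex` (rung K7t): the Tamagawa product of `E_p : x³ + y³ = p` and its
# `2`-PART — `c_W = c₃·c_p` with `c_p ∈ {1, 3}`, `c₃ = 2` (`p ≡ 7 (mod 9)`) / `c₃ ∈ {1, 3}`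
# (`p ≡ 4 (mod 9)`), hence `ord₂ c_W = [p ≡ 7 (mod 9)]`, modulo the tree's Kodaira→`c_v` facts

Cell `b2b-bsdres`, unit `b2b-bsdres-x1b` (X12 prover owner / O12 class lead, gen 47). HONEST FRAMING
(verbatim in every file of the cell): the cell DELETES the combination-shaped residual classes of the
BSD formula in analytic rank `≤ 1` from PUBLISHED theorems only and TYPES the construction-shaped ones;
O12 is CONSTRUCTION-SHAPED and stays so; tool theorems only, CONDITIONAL on the displayed hypotheses;
nothing booked; no label moves. Companion of `…Theorems.SylvesterTwoHeegnerIndexLocalTypes` (x1b gen 47,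
p421557: Kodaira `IV` at `p`, `III*`/`IV*` at `3` by `p mod 9`, every model, NO named fact). HERE the
Tamagawa factor `c_W = W.tamagawaProduct` of `P2.cmHeegnerIndexQuotient` (the `2`-adic frame quotient of
both K7t cruxes) is evaluated for every model `B` of `E_p`: the finite product over the places of `ℚ`
collapses to the two bad places `3` and `p` (`c_v = 1` at good `v`, the tree's PROVED
`localTamagawaNumber_eq_one_of_hasGoodReductionAt_holds`; good away from `3p`:
`X12.Sylvester.good_of_model`), and the two factors are read off the Kodaira symbols through the tree's
NAMED FACTS of `NeronComponentIndex.lean` (Silverman *ATAEC* IV.9.4 Steps 5, 8, 9 — `c ∈ {1,3}` for `IV`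
and `IV*`, `c = 2` for `III*`), taken as DISPLAYED hypotheses `hIV hIVs hIIIs`:
* `tamagawaProduct_eq_mul_of_model` — `c_W = c₃ · c_p` (the two local numbers at the places over `3`, `p`);
* `tamagawaProduct_of_model_of_mod_nine_eq_seven` — `p ≡ 7 (9)`: `∃ c ∈ {1,3}, c_W = 2·c`, so
  `padicValNat 2 c_W = 1`; `tamagawaProduct_of_model_of_mod_nine_eq_four` — `p ≡ 4 (9)`:
  `∃ c c' ∈ {1,3}, c_W = c·c'`, so `padicValNat 2 c_W = 0`;
* `padicValNat_two_tamagawaProduct_of_model` — both residues: `ord₂ c_W = if p % 9 = 7 then 1 else 0`.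
PARI agrees (`c₃ = 2 / 1`, `c_p = 3`, kit j248952, p ≡ 4,7 (9) up to 373 — EVIDENCE, unused). Not here:
`c_p = 3` exactly (the splitting of `T² + T + 7` over `𝔽_p`, true as `p ≡ 1 (mod 3)`, is not needed for
the `2`-part), the place `2` (good), anything about the cruxes.

References: J. H. Silverman, *ATAEC* IV.9.4 Steps 5/8/9 and Table 4.1, Rem. IV.9.3; *AEC* VII.2 (after
Prop. 2.1); HOME `b2b-bsdres-x1b/X12-ROUTE.md` §51.
-/

set_option autoImplicit false
set_option linter.dupNamespace false

noncomputable section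

open scoped Classical NumberField

open WeierstrassCurve NumberField IsDedekindDomain IsDedekindDomain.HeightOneSpectrum
  Rat.HeightOneSpectrum Literature.NumberTheory.EllipticCurves
  Literature.NumberTheory.EllipticCurves.HuShuYin2019
  Literature.NumberTheory.EllipticCurves.Rank1Residual
  Literature.NumberTheory.EllipticCurves.Rank1Residual.Typed
  Literature.NumberTheory.DiophantineGeometry
  Summit.BirchSwinnertonDyer.Rank1Residual
  Summit.BirchSwinnertonDyer.Rank1Residual.X12.Sylvester
  Summit.BirchSwinnertonDyer.BirchSwinnertonDyer.Theorems.SylvesterTwoLocalTypes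

namespace Summit.BirchSwinnertonDyer.BirchSwinnertonDyer.Theorems.SylvesterTwoTamagawa

/-- At a place `v` of good reduction (`Good B ℓ`, `ℓ` the prime under `v`) the local Tamagawa number
`c_v(B) = (B ⊗ ℚ_v).localTamagawaNumber O_v` is `1` (the tree's proved
`localTamagawaNumber_eq_one_of_hasGoodReductionAt_holds`). [cite: SilvermanAEC2009, VII.2 (remark after Prop. 2.1)] -/
theorem localTamagawaNumber_eq_one_of_good (B : WeierstrassCurve ℚ) [B.IsElliptic]
    (v : HeightOneSpectrum (𝓞 ℚ)) {ℓ : ℕ} [Fact ℓ.Prime] (hv : natGenerator v = ℓ) (hg : Good B ℓ) :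
    (B.baseChange (v.adicCompletion ℚ)).localTamagawaNumber (v.adicCompletionIntegers ℚ) = 1 :=
  B.localTamagawaNumber_eq_one_of_hasGoodReductionAt_holds v ((X12.good_iff_hasGoodReductionAt B ℓ v hv).mp hg)

section Places

variable {p : ℕ}

/-- The place of `ℚ` over a prime `ℓ`. [folklore] -/
theorem exists_place (ℓ : ℕ) (hℓ : ℓ.Prime) : ∃ v : HeightOneSpectrum (𝓞 ℚ), natGenerator v = ℓ :=
  ⟨primesEquiv.symm ⟨ℓ, hℓ⟩, by
    rw [show natGenerator _ = (primesEquiv (primesEquiv.symm ⟨ℓ, hℓ⟩) : ℕ) from rfl, Equiv.apply_symm_apply]⟩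

/-- Two places with the same residue characteristic are equal. [folklore] -/
theorem place_eq_of_natGenerator_eq {v w : HeightOneSpectrum (𝓞 ℚ)} (h : natGenerator v = natGenerator w) :
    v = w := by
  apply primesEquiv.injective
  exact Subtype.ext h

/-- **`c_W = c₃ · c_p`** for every model `B` of `E_p` (`p` prime, `p ≡ 4, 7 (mod 9)`): the finite product
of the local Tamagawa numbers over the places of `ℚ` has multiplicative support inside `{v₃, v_p}`
(good reduction away from `3p`, `X12.Sylvester.good_of_model`, and `c_v = 1` at good `v`).
[cite: SilvermanAEC2009, VII.2 (remark after Prop. 2.1) and VII.5 Prop. 5.1] -/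
theorem tamagawaProduct_eq_mul_of_model (hp : p.Prime) (h9 : p % 9 = 4 ∨ p % 9 = 7)
    (B : WeierstrassCurve ℚ) [B.IsElliptic] [B.IsGloballyMinimal]
    (hB : ∃ C : VariableChange ℚ, C • B = cubeSumCurve (p : ℚ))
    (v₃ vp : HeightOneSpectrum (𝓞 ℚ)) (h₃ : natGenerator v₃ = 3) (hvp : natGenerator vp = p) :
    B.tamagawaProduct =
      (B.baseChange (v₃.adicCompletion ℚ)).localTamagawaNumber (v₃.adicCompletionIntegers ℚ) *
        (B.baseChange (vp.adicCompletion ℚ)).localTamagawaNumber (vp.adicCompletionIntegers ℚ) := by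
  have hp3 : p ≠ 3 := ne_three_of_mod_nine h9
  have hne : v₃ ≠ vp := fun h ↦ hp3 (by rw [← hvp, ← h, h₃])
  set f : HeightOneSpectrum (𝓞 ℚ) → ℕ := fun v ↦
    (B.baseChange (v.adicCompletion ℚ)).localTamagawaNumber (v.adicCompletionIntegers ℚ) with hf
  have hsupp : Function.mulSupport f ⊆ (({v₃, vp} : Finset (HeightOneSpectrum (𝓞 ℚ))) : Set _) := by
    intro v hv
    simp only [Finset.coe_insert, Finset.coe_singleton, Set.mem_insert_iff, Set.mem_singleton_iff]
    by_contra hnot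
    simp only [not_or] at hnot
    apply hv
    haveI : Fact (natGenerator v).Prime := ⟨prime_natGenerator v⟩
    have hℓ3 : natGenerator v ≠ 3 := fun h ↦ hnot.1 (place_eq_of_natGenerator_eq (h.trans h₃.symm))
    have hℓp : natGenerator v ≠ p := fun h ↦ hnot.2 (place_eq_of_natGenerator_eq (h.trans hvp.symm))
    exact localTamagawaNumber_eq_one_of_good B v rfl (good_of_model B hp hp3 hB hℓ3 hℓp)
  unfold WeierstrassCurve.tamagawaProduct
  rw [finprod_eq_prod_of_mulSupport_subset f hsupp, Finset.prod_pair hne]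

/-- **`p ≡ 7 (mod 9)`: `c_W = 2·c` with `c ∈ {1, 3}`** for every model `B` of `E_p`: `c₃ = 2` (Kodaira
`III*` at `3`, named fact `hIIIs` = *ATAEC* IV.9.4 Step 9) and `c_p ∈ {1, 3}` (Kodaira `IV` at `p`,
named fact `hIV` = Step 5). CONDITIONAL on `hIV hIIIs`. [cite: SilvermanATAEC1994, IV.9.4 Steps 5 and 9, Rem. IV.9.3] -/
theorem tamagawaProduct_of_model_of_mod_nine_eq_seven (hp : p.Prime) (h9 : p % 9 = 7)
    (B : WeierstrassCurve ℚ) [B.IsElliptic] [B.IsGloballyMinimal]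
    (hB : ∃ C : VariableChange ℚ, C • B = cubeSumCurve (p : ℚ))
    (hIV : ∀ v : HeightOneSpectrum (𝓞 ℚ), localTamagawaNumber_of_kodairaSymbolAt_eq_IV v B)
    (hIIIs : ∀ v : HeightOneSpectrum (𝓞 ℚ), localTamagawaNumber_eq_two_of_kodairaSymbolAt_eq_IIIstar v B) :
    ∃ c : ℕ, (c = 1 ∨ c = 3) ∧ B.tamagawaProduct = 2 * c := by
  obtain ⟨v₃, h₃⟩ := exists_place 3 Nat.prime_three
  obtain ⟨vp, hvp⟩ := exists_place p hp
  have hp5 : 5 ≤ p := by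
    by_contra hlt; interval_cases p <;> simp_all (config := {decide := true})
  haveI := perfectField_residueField_adicCompletionIntegers (K := ℚ) v₃
  haveI := perfectField_residueField_adicCompletionIntegers (K := ℚ) vp
  have hc3 := hIIIs v₃ (kodairaSymbolAt_three_of_model_of_mod_nine_eq_seven hp h9 B hB v₃ h₃)
  have hcp := hIV vp (kodairaSymbolAt_self_of_model hp hp5 B hB vp hvp)
  refine ⟨_, hcp, ?_⟩
  rw [tamagawaProduct_eq_mul_of_model hp (Or.inr h9) B hB v₃ vp h₃ hvp, hc3]

/-- **`p ≡ 4 (mod 9)`: `c_W = c·c'` with `c, c' ∈ {1, 3}`** for every model `B` of `E_p`: `c₃ ∈ {1, 3}`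
(Kodaira `IV*` at `3`, named fact `hIVs` = *ATAEC* IV.9.4 Step 8) and `c_p ∈ {1, 3}` (`IV` at `p`, `hIV`).
CONDITIONAL on `hIV hIVs`. [cite: SilvermanATAEC1994, IV.9.4 Steps 5 and 8, Rem. IV.9.3] -/
theorem tamagawaProduct_of_model_of_mod_nine_eq_four (hp : p.Prime) (h9 : p % 9 = 4)
    (B : WeierstrassCurve ℚ) [B.IsElliptic] [B.IsGloballyMinimal]
    (hB : ∃ C : VariableChange ℚ, C • B = cubeSumCurve (p : ℚ))
    (hIV : ∀ v : HeightOneSpectrum (𝓞 ℚ), localTamagawaNumber_of_kodairaSymbolAt_eq_IV v B)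
    (hIVs : ∀ v : HeightOneSpectrum (𝓞 ℚ), localTamagawaNumber_of_kodairaSymbolAt_eq_IVstar v B) :
    ∃ c c' : ℕ, (c = 1 ∨ c = 3) ∧ (c' = 1 ∨ c' = 3) ∧ B.tamagawaProduct = c * c' := by
  obtain ⟨v₃, h₃⟩ := exists_place 3 Nat.prime_three
  obtain ⟨vp, hvp⟩ := exists_place p hp
  have hp5 : 5 ≤ p := by
    by_contra hlt; interval_cases p <;> simp_all (config := {decide := true})
  haveI := perfectField_residueField_adicCompletionIntegers (K := ℚ) v₃
  haveI := perfectField_residueField_adicCompletionIntegers (K := ℚ) vp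
  have hc3 := hIVs v₃ (kodairaSymbolAt_three_of_model_of_mod_nine_eq_four hp h9 B hB v₃ h₃)
  have hcp := hIV vp (kodairaSymbolAt_self_of_model hp hp5 B hB vp hvp)
  exact ⟨_, _, hc3, hcp, tamagawaProduct_eq_mul_of_model hp (Or.inl h9) B hB v₃ vp h₃ hvp⟩

/-- **THE `2`-PART OF `c_W` ON 𝒞_HSY: `ord₂ (c₃·c_p)(E_p) = [p ≡ 7 (mod 9)]`** for every model `B` of `E_p`,
`p ≡ 4, 7 (mod 9)` prime, modulo the three Kodaira→`c_v` named facts (`hIV hIVs hIIIs`). This is the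
`c_W`-term of the `2`-adic Heegner-index quotient `P2.cmHeegnerIndexQuotient` in every frame of the K7t
cruxes. [cite: SilvermanATAEC1994, IV.9.4 Steps 5, 8, 9 and Table 4.1] -/
theorem padicValNat_two_tamagawaProduct_of_model (hp : p.Prime) (h9 : p % 9 = 4 ∨ p % 9 = 7)
    (B : WeierstrassCurve ℚ) [B.IsElliptic] [B.IsGloballyMinimal]
    (hB : ∃ C : VariableChange ℚ, C • B = cubeSumCurve (p : ℚ))
    (hIV : ∀ v : HeightOneSpectrum (𝓞 ℚ), localTamagawaNumber_of_kodairaSymbolAt_eq_IV v B)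
    (hIVs : ∀ v : HeightOneSpectrum (𝓞 ℚ), localTamagawaNumber_of_kodairaSymbolAt_eq_IVstar v B)
    (hIIIs : ∀ v : HeightOneSpectrum (𝓞 ℚ), localTamagawaNumber_eq_two_of_kodairaSymbolAt_eq_IIIstar v B) :
    padicValNat 2 B.tamagawaProduct = if p % 9 = 7 then 1 else 0 := by
  haveI : Fact (Nat.Prime 2) := ⟨Nat.prime_two⟩
  have hodd13 : ∀ c : ℕ, c = 1 ∨ c = 3 → padicValNat 2 c = 0 := by
    rintro c (rfl | rfl) <;> exact padicValNat.eq_zero_of_not_dvd (by norm_num)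
  rcases h9 with h4 | h7
  · rw [if_neg (by omega)]
    obtain ⟨c, c', hc, hc', hT⟩ := tamagawaProduct_of_model_of_mod_nine_eq_four hp h4 B hB hIV hIVs
    have hc0 : c ≠ 0 := by rcases hc with rfl | rfl <;> norm_num
    have hc0' : c' ≠ 0 := by rcases hc' with rfl | rfl <;> norm_num
    rw [hT, padicValNat.mul hc0 hc0', hodd13 c hc, hodd13 c' hc']
  · rw [if_pos h7]
    obtain ⟨c, hc, hT⟩ := tamagawaProduct_of_model_of_mod_nine_eq_seven hp h7 B hB hIV hIIIs
    have hc0 : c ≠ 0 := by rcases hc with rfl | rfl <;> norm_num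
    rw [hT, padicValNat.mul (by norm_num) hc0, hodd13 c hc, padicValNat.self (by norm_num)]

end Places

end Summit.BirchSwinnertonDyer.BirchSwinnertonDyer.Theorems.SylvesterTwoTamagawa

end
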